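import Mathlib
import Summits.KontsevichZagierPeriods.KontsevichZagierPeriods.Theorems.CompiledSubstitutionsPiNormalisation
import Literature.NumberTheory.Transcendental.KZBallPeelingAux

/-!
# `TateLifting` (stmt-KontsevichZagierPeriods-9129), line `Sketch` — stub `stub_quarterPi`

QUARTER-CIRCLE NORMALISATION in the Kontsevich–Zagier calculus: every honest one-dimensional
representation `r = [(0,1), 4 dx/(1+x²)]` of `π` (domain the open unit cube of `ℝ¹`, integrand
agreeing with `4/(1+x²)` on it) is `KZ.Equivalent` to the closed-unit-disc representation
`KZ.piRep = [{x²+y² ≤ 1}, 1]`.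

## Proof

Take the arctangent representation `T = [(-1,1), 2 dt/(1+t²)]`
(`PiNormalisation.exists_arctanRep`); `T ∼ piRep` is the landed stub `stub_piAsArctan`
(substitution `x = 2t/(1+t²)` onto `[(-1,1), dx/√(1−x²)]`, then Kontsevich–Zagier's §1.1 chain).
Fold `T` onto `(0,1)` exactly as in the symmetric Beta fold of `KZBallPeelingAux.lean`:
remove the null point `t = 0` (`KZ.IntegralRep.of_sub_of_restrict_mem_relations`), split
`(-1,0) ∪ (0,1)` (rule (1a), `KZ.domainAddRel`), reflect `(-1,0)` onto `(0,1)` by `t ↦ −t`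
(rule (2), `KZ.BallPeeling.of_sub_of_mem_relations_of_neg`; the integrand is even), and merge the
two equal copies `H = [(0,1), 2/(1+t²)]` into `r` (rule (1b), `KZ.integrandAddRel`:
`4/(1+t²) = 2/(1+t²) + 2/(1+t²)` on `(0,1)`). Bookkeeping in the free abelian group `FormalRep`:
`[r] − [piRep] = ([r] − [H] − [H]) − ([T⁻] − [H]) − ([T'] − [T⁻] − [H]) − ([T] − [T']) + ([T] − [piRep])`.

References: M. Kontsevich, D. Zagier, *Periods* (2001), §1.1 eq. (1), §1.2 rules (1), (2).
-/

noncomputable section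

namespace Summit.KontsevichZagierPeriods.InverseLandau

open MeasureTheory Set
open Literature.NumberTheory.Transcendental
open Literature.NumberTheory.Transcendental.KZ
open Literature.NumberTheory.Transcendental.KZ.BallPeeling
  (isSemialgebraic_negIoo isSemialgebraic_posIoo volume_setOf_apply_eq_const
    of_sub_of_mem_relations_of_neg)
open Summit.KontsevichZagierPeriods.CompiledSubstitutions.PiNormalisation (exists_arctanRep)
open Summit.KontsevichZagierPeriods.KontsevichZagierPeriods.BetaCancellationLine (stub_piAsArctan)

/-- The open unit cube of `ℝ¹` is the interval `(0,1)` read on the only coordinate. [folklore] -/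
theorem pi_univ_Ioo_fin_one :
    Set.pi Set.univ (fun _ : Fin 1 => Set.Ioo (0 : ℝ) 1) = {x : Fin 1 → ℝ | x 0 ∈ Set.Ioo (0:ℝ) 1} := by
  ext x
  simp only [mem_univ_pi, Fin.forall_fin_one, mem_setOf_eq]

/-- **Folding the arctangent representation** (rules (1a), (2), (1b)): for `T = [(-1,1), f]` with
`f = 2/(1+t²)` on `(-1,1)` and any `r` with domain `(0,1)` and integrand `4/(1+t²)` on it,
`[r] − [T] ∈ KZ.relations` — remove the null point `0`, split `(-1,0) ∪ (0,1)`, reflect the left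
half onto the right one (`f` is even), merge the two copies. [cite: KontsevichZagier2001, §1.2] -/
theorem of_sub_of_arctanRep_mem_relations (r T : IntegralRep 1)
    (hTd : T.domain = {x | x 0 ∈ Set.Ioo (-1:ℝ) 1})
    (hTi : Set.EqOn T.integrand (fun x => 2 / (1 + x 0 ^ 2)) T.domain)
    (hrd : r.domain = {x | x 0 ∈ Set.Ioo (0:ℝ) 1})
    (hri : Set.EqOn r.integrand (fun x => 4 / (1 + x 0 ^ 2)) r.domain) :
    of r - of T ∈ relations := by
  have hneg_sub : {x : Fin 1 → ℝ | x 0 ∈ Set.Ioo (-1:ℝ) 0} ⊆ T.domain := by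
    rw [hTd]
    exact fun x hx => ⟨hx.1, hx.2.trans zero_lt_one⟩
  have hpos_sub : {x : Fin 1 → ℝ | x 0 ∈ Set.Ioo (0:ℝ) 1} ⊆ T.domain := by
    rw [hTd]
    exact fun x hx => ⟨neg_one_lt_zero.trans hx.1, hx.2⟩
  have hUsa := isSemialgebraic_negIoo.union isSemialgebraic_posIoo
  have hU_sub := union_subset hneg_sub hpos_sub
  obtain ⟨Tn, hTnd, hTni⟩ : ∃ s : IntegralRep 1, s.domain = {x | x 0 ∈ Set.Ioo (-1:ℝ) 0} ∧
      s.integrand = T.integrand := ⟨T.restrict _ isSemialgebraic_negIoo hneg_sub, rfl, rfl⟩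
  obtain ⟨H, hHd, hHi⟩ : ∃ s : IntegralRep 1, s.domain = {x | x 0 ∈ Set.Ioo (0:ℝ) 1} ∧
      s.integrand = T.integrand := ⟨T.restrict _ isSemialgebraic_posIoo hpos_sub, rfl, rfl⟩
  -- (1) the null point `t = 0`
  have h1 : of T - of (T.restrict _ hUsa hU_sub) ∈ relations := by
    refine T.of_sub_of_restrict_mem_relations hUsa hU_sub
      (measure_mono_null (fun x hx => ?_) (volume_setOf_apply_eq_const 1 0 0))
    rw [hTd] at hx
    obtain ⟨⟨hl, hr⟩, h3⟩ := hx
    simp only [mem_union, mem_setOf_eq, mem_Ioo, not_or, not_and, not_lt] at h3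
    show x 0 = 0
    rcases lt_trichotomy (x 0) 0 with h | h | h
    · exact absurd (h3.1 hl) (not_le.2 h)
    · exact h
    · exact absurd hr (not_lt.2 (h3.2 h))
  -- (2) domain additivity `(−1,0) ∪ (0,1)`
  have h2 : of (T.restrict _ hUsa hU_sub) - of Tn - of H ∈ relations := by
    refine domainAddRel_subset_relations ⟨1, _, Tn, H, by rw [hTnd, hHd]; rfl, ?_,
      fun x _ => by rw [hTni]; rfl, fun x _ => by rw [hHi]; rfl, rfl⟩
    rw [hTnd, hHd]
    refine measure_mono_null (fun x hx => ?_) measure_empty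
    simp only [mem_inter_iff, mem_setOf_eq, mem_Ioo] at hx
    linarith [hx.1.2, hx.2.1]
  -- (3) fold `(−1,0)` onto `(0,1)` by `t ↦ −t` (the integrand `2/(1+t²)` is even)
  have h3 : of Tn - of H ∈ relations := by
    refine of_sub_of_mem_relations_of_neg ?_ fun x hx => ?_
    · rw [hTnd, hHd]
      ext y
      simp only [mem_setOf_eq, mem_Ioo, mem_image]
      constructor
      · rintro ⟨h0, h1⟩
        exact ⟨-y, ⟨by simp; linarith, by simp; linarith⟩, neg_neg y⟩
      · rintro ⟨x, ⟨h0, h1⟩, rfl⟩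
        simp only [Pi.neg_apply]
        exact ⟨by linarith, by linarith⟩
    · rw [hTnd] at hx
      have hx' : x ∈ T.domain := hneg_sub hx
      have hnx : -x ∈ T.domain := hpos_sub (by
        simp only [mem_setOf_eq, mem_Ioo, Pi.neg_apply]
        exact ⟨by linarith [hx.2], by linarith [hx.1]⟩)
      rw [hTni, hHi, hTi hx', hTi hnx]
      simp
  -- (4) merge the two copies: `[r] − [H] − [H]` is integrand additivity (`4 = 2 + 2`)
  have h4 : of r - of H - of H ∈ relations := by
    refine integrandAddRel_subset_relations ⟨1, r, H, H, by rw [hHd, hrd], by rw [hHd, hrd],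
      fun x hx => ?_, rfl⟩
    have hxT : x ∈ T.domain := hpos_sub (by rw [hrd] at hx; exact hx)
    simp only [Pi.add_apply, hHi, hri hx, hTi hxT]
    ring
  have : of r - of T = (of r - of H - of H) - (of Tn - of H) -
      (of (T.restrict _ hUsa hU_sub) - of Tn - of H) - (of T - of (T.restrict _ hUsa hU_sub)) := by
    abel
  rw [this]
  exact relations.sub_mem (relations.sub_mem (relations.sub_mem h4 h3) h2) h1

/-- **Quarter-circle normalisation** (stub `stub_quarterPi` of the lead's skeleton, the body of
`QuarterPi`): every representation with domain the open unit cube of `ℝ¹` and integrand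
`4/(1+x²)` on it is KZ-equivalent to the disc `KZ.piRep = [{x²+y² ≤ 1}, 1]`
(`π = ∫₀¹ 4 dx/(1+x²) = ∬_{x²+y²≤1} dx dy` inside the calculus): fold the arctangent
representation `[(-1,1), 2 dt/(1+t²)]` onto `(0,1)` (`of_sub_of_arctanRep_mem_relations`) and
use `[(-1,1), 2 dt/(1+t²)] ∼ [disc, 1]` (`stub_piAsArctan`).
[cite: KontsevichZagier2001, §1.1 eq. (1)] -/
theorem tateLifting_quarterPi :
    ∀ r : KZ.IntegralRep 1, r.domain = Set.pi Set.univ (fun _ => Set.Ioo (0 : ℝ) 1) →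
      Set.EqOn r.integrand (fun x => 4 / (1 + x 0 ^ 2)) r.domain → KZ.Equivalent r KZ.piRep := by
  intro r hrd hri
  obtain ⟨T, hTd, hTi⟩ := exists_arctanRep
  have hTP : Equivalent T piRep :=
    stub_piAsArctan T piRep hTd (fun x _ => by rw [hTi]) rfl (fun _ _ => rfl)
  have hrT : of r - of T ∈ relations :=
    of_sub_of_arctanRep_mem_relations r T hTd (fun x _ => by rw [hTi]) (hrd.trans pi_univ_Ioo_fin_one)
      hri
  exact Equivalent.trans (r' := T) hrT hTP

end Summit.KontsevichZagierPeriods.InverseLandau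

end
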